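import Mathlib
import HarnessLib
import Summits.NavierStokesRegularity.NavierStokesRegularity.Theorems.TaylorModelRungThreeCertificateCoreStepSoundA

/-!
# Crux K1b-DR (stmt-NavierStokesRegularity-23954), line `taylor-model` — the sub-step core, part 4: SOUNDNESS of `coreStep` for the
# conjuncts (D1κ), (V1) and (JU) of `ChainVCore` (`…TaylorModelRungThreeVDefs`, verbatim shapes)

With `out := T.coreStep ci`, `out.ok = true`, `ci.mt = T.monosTable ci.coefB`, `CoefOK`/`CoefBoxOK`, and a real pair `κ`, `ω` enclosed by the
input boxes (`κ·ω k ∈ ci.κωB[idx i k]`, `ω k ∈ ci.ωB[idx i k]` on the window):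
* `coreStep_K_box`, `coreStep_K_row` — `loK ≤ 0 ≤ hiK`, `loK ≤ −κω_k`, `κω_k ≤ hiK`, `max |loK| |hiK| ≤ L1·κ·ω_k`;
* `coreStep_K_test` — the first-order DIFFERENCE test over tube × BK: `d₀ + u • (Qb y d + Qb d y + Qb d d) ∈ [loK, hiK]` for `|d₀| ≤ κω`;
* `coreStep_V_box`, `coreStep_V_row`, `coreStep_V_test` — the same for the unit-`ω` variation box over the doubled tube;
* `coreStep_JU` — `|varJet d.Qb y v (pV+1) i k| ≤ JU i k` for `y` in the doubled tube box and `v ∈ BV`.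

MODEL-lattice bookkeeping only (rung TL-M3); nothing here concerns the Navier–Stokes equations.
-/

-- the sub-problem namespace repeats the summit name by design (D-0017)
set_option linter.dupNamespace false

namespace Summit.NavierStokesRegularity.NavierStokesRegularity.Theorems.TaylorModelCert

open scoped BigOperators
open Set
open Literature.Analysis.FluidPDE.TaoCascade Literature.Analysis.FluidPDE.TaoCascade.TaylorChain
open Summit.NavierStokesRegularity.NavierStokesRegularity.Theorems.TaylorModelReadout (qB Qb_eq taylorJet taylorJet_zero varJet)

namespace CertTables

variable {K : Type} [Field K] {φ : K →+* ℝ} (T : CertTables K) (ci : CoreIn)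

/-! ### (D1κ) -/

omit [Field K] in
/-- **(D1κ) box facts**: `loK ≤ 0 ≤ hiK`, `loK ≤ −κω_k`, `κω_k ≤ hiK`. [folklore] -/
theorem coreStep_K_box (hok : (T.coreStep ci).ok = true) {κ : ℝ} {ω : ℤ → ℝ}
    (hκω : ∀ i k, -T.Kb ≤ k → k ≤ T.Ka → IntervalD.mem (κ * ω k) (IntervalD.aget ci.κωB (T.idx i k))) :
    ∀ i k, -T.Kb ≤ k → k ≤ T.Ka →
      T.vecF (vre (T.coreStep ci).loK) i k ≤ 0 ∧ 0 ≤ T.vecF (vre (T.coreStep ci).hiK) i k ∧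
        T.vecF (vre (T.coreStep ci).loK) i k ≤ -(κ * ω k) ∧ κ * ω k ≤ T.vecF (vre (T.coreStep ci).hiK) i k := by
  intro i k hk1 hk2
  have hk : -T.Kb ≤ k ∧ k ≤ T.Ka := ⟨hk1, hk2⟩
  have hc : T.idx i k < T.n := T.idx_lt_n i hk
  obtain ⟨hbox, -, -⟩ := IntervalD.testK_sound (T.coreStep_okK ci hok) hc (hκω i k hk1 hk2)
  rw [T.vecF_vre _ i hk, T.vecF_vre _ i hk, T.out_loK ci _ hc, CoreIn.coreStep_hiK]
  exact hbox

omit [Field K] in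
/-- **(D1κ) row bound**: `max |loK| |hiK| ≤ L1·κ·ω_k`. [folklore] -/
theorem coreStep_K_row (hok : (T.coreStep ci).ok = true) {κ : ℝ} {ω : ℤ → ℝ}
    (hκω : ∀ i k, -T.Kb ≤ k → k ≤ T.Ka → IntervalD.mem (κ * ω k) (IntervalD.aget ci.κωB (T.idx i k))) :
    ∀ i k, -T.Kb ≤ k → k ≤ T.Ka →
      max |T.vecF (vre (T.coreStep ci).loK) i k| |T.vecF (vre (T.coreStep ci).hiK) i k| ≤ (T.coreStep ci).L1.toReal * κ * ω k := by
  intro i k hk1 hk2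
  have hk : -T.Kb ≤ k ∧ k ≤ T.Ka := ⟨hk1, hk2⟩
  have hc : T.idx i k < T.n := T.idx_lt_n i hk
  obtain ⟨-, hrow, -⟩ := IntervalD.testK_sound (T.coreStep_okK ci hok) hc (hκω i k hk1 hk2)
  rw [T.vecF_vre _ i hk, T.vecF_vre _ i hk, T.out_loK ci _ hc, CoreIn.coreStep_hiK, CoreIn.coreStep_L1, mul_assoc]
  exact hrow

/-- The symmetrised field and the diagonal at a window coordinate, through `qBf`. [folklore] -/
theorem Qb_sym_apply (y dd : Fin 4 → ℤ → ℝ) (i : Fin 4) (k : ℤ) :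
    ((T.toCertData φ).Qb y dd + (T.toCertData φ).Qb dd y) i k = qBf (T.toCertData φ) y dd i k + qBf (T.toCertData φ) dd y i k := by
  simp only [Pi.add_apply, Qb_eq, qBf]; ring

/-- [folklore] -/
theorem Qb_diag_apply (dd : Fin 4 → ℤ → ℝ) (i : Fin 4) (k : ℤ) :
    (T.toCertData φ).Qb dd dd i k = qBf (T.toCertData φ) dd dd i k := by
  simp only [Qb_eq, qBf]; ring

/-- **(D1κ) first-order difference test** over tube × BK, for every `κω`-small start `d₀`. [folklore] -/
theorem coreStep_K_test (hco : T.CoefOK φ) (hcB : CoefBoxOK φ T ci.coefB) (hmt : ci.mt = T.monosTable ci.coefB)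
    (hok : (T.coreStep ci).ok = true) {κ : ℝ} {ω : ℤ → ℝ}
    (hκω : ∀ i k, -T.Kb ≤ k → k ≤ T.Ka → IntervalD.mem (κ * ω k) (IntervalD.aget ci.κωB (T.idx i k))) :
    ∀ d₀ : Fin 4 → ℤ → ℝ, T.InBallW ω d₀ κ →
      ∀ y dd, T.InBoxW (T.vecF (vre (T.coreStep ci).lo) + T.vecF (vre (T.coreStep ci).loK))
          (T.vecF (vre (T.coreStep ci).hi) + T.vecF (vre (T.coreStep ci).hiK)) y →
        T.InBoxW (T.vecF (vre (T.coreStep ci).loK)) (T.vecF (vre (T.coreStep ci).hiK)) dd → ∀ u ∈ Icc 0 ci.h.toReal,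
          T.InBoxW (T.vecF (vre (T.coreStep ci).loK)) (T.vecF (vre (T.coreStep ci).hiK))
            (d₀ + u • ((T.toCertData φ).Qb y dd + (T.toCertData φ).Qb dd y + (T.toCertData φ).Qb dd dd)) := by
  intro d₀ hd₀ y dd hy hdd u hu i k hk1 hk2
  have hk : -T.Kb ≤ k ∧ k ≤ T.Ka := ⟨hk1, hk2⟩
  have hc : T.idx i k < T.n := T.idx_lt_n i hk
  have hyc := T.mem_TB_of_inBoxW ci hy
  have hdc := T.mem_BK_of_inBoxW ci hdd
  -- the field range at this coordinate
  have hlin : IntervalD.IsLinSymEnclosureF T.wv (qBf (T.toCertData φ)) T.n ci.prec (T.linSym ci.coefB ci.prec ci.mt) := by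
    rw [hmt]; exact T.isLinSymEnclosureF_linSym hco hcB ci.prec
  have h1 := hlin (ci.TB T) (ci.BK T) y dd (CoreIn.size_TB T ci) (CoreIn.size_BK T ci) hyc hdc (T.idx i k) hc
  have h2 := T.coreQBA_sound ci hco hcB hmt (ci.BK T) (ci.BK T) dd dd (CoreIn.size_BK T ci) (CoreIn.size_BK T ci) hdc hdc (T.idx i k) hc
  have hg : IntervalD.mem (((T.toCertData φ).Qb y dd + (T.toCertData φ).Qb dd y + (T.toCertData φ).Qb dd dd) i k)
      (IntervalD.aget (ci.G T) (T.idx i k)) := by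
    unfold CoreIn.G; rw [IntervalD.aget_ofFn _ hc]
    have e : ((T.toCertData φ).Qb y dd + (T.toCertData φ).Qb dd y + (T.toCertData φ).Qb dd dd) i k =
        (T.wv (qBf (T.toCertData φ) y dd) (T.idx i k) + T.wv (qBf (T.toCertData φ) dd y) (T.idx i k)) +
          T.wv (qBf (T.toCertData φ) dd dd) (T.idx i k) := by
      simp only [Pi.add_apply, T.wv_idx _ i hk, Qb_eq, qBf]; ring
    rw [e]; exact IntervalD.mem_addR ci.prec h1 h2
  have hball : |d₀ i k| ≤ κ * ω k := hd₀ i k hk1 hk2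
  have hm := IntervalD.mem_symBox_of_testK (T.coreStep_okK ci hok) hc (hκω i k hk1 hk2) hball hu hg
  rw [T.vecF_vre _ i hk, T.vecF_vre _ i hk, T.out_loK ci _ hc, CoreIn.coreStep_hiK]
  simp only [Pi.add_apply, Pi.smul_apply, smul_eq_mul]
  exact hm

/-! ### (V1) -/

omit [Field K] in
/-- **(V1) box facts**: `loV ≤ −ω_k`, `ω_k ≤ hiV`. [folklore] -/
theorem coreStep_V_box (hok : (T.coreStep ci).ok = true) {ω : ℤ → ℝ}
    (hωB : ∀ i k, -T.Kb ≤ k → k ≤ T.Ka → IntervalD.mem (ω k) (IntervalD.aget ci.ωB (T.idx i k))) :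
    ∀ i k, -T.Kb ≤ k → k ≤ T.Ka → T.vecF (vre (T.coreStep ci).loV) i k ≤ -ω k ∧ ω k ≤ T.vecF (vre (T.coreStep ci).hiV) i k := by
  intro i k hk1 hk2
  have hk : -T.Kb ≤ k ∧ k ≤ T.Ka := ⟨hk1, hk2⟩
  have hc : T.idx i k < T.n := T.idx_lt_n i hk
  obtain ⟨⟨-, -, h3, h4⟩, -, -⟩ := IntervalD.testK_sound (T.coreStep_okV ci hok) hc (hωB i k hk1 hk2)
  rw [T.vecF_vre _ i hk, T.vecF_vre _ i hk, T.out_loV ci _ hc, CoreIn.coreStep_hiV]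
  exact ⟨h3, h4⟩

omit [Field K] in
/-- **(V1) row bound**: `max |loV| |hiV| ≤ L1·ω_k`. [folklore] -/
theorem coreStep_V_row (hok : (T.coreStep ci).ok = true) {ω : ℤ → ℝ}
    (hωB : ∀ i k, -T.Kb ≤ k → k ≤ T.Ka → IntervalD.mem (ω k) (IntervalD.aget ci.ωB (T.idx i k))) :
    ∀ i k, -T.Kb ≤ k → k ≤ T.Ka →
      max |T.vecF (vre (T.coreStep ci).loV) i k| |T.vecF (vre (T.coreStep ci).hiV) i k| ≤ (T.coreStep ci).L1.toReal * ω k := by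
  intro i k hk1 hk2
  have hk : -T.Kb ≤ k ∧ k ≤ T.Ka := ⟨hk1, hk2⟩
  have hc : T.idx i k < T.n := T.idx_lt_n i hk
  obtain ⟨-, hrow, -⟩ := IntervalD.testK_sound (T.coreStep_okV ci hok) hc (hωB i k hk1 hk2)
  rw [T.vecF_vre _ i hk, T.vecF_vre _ i hk, T.out_loV ci _ hc, CoreIn.coreStep_hiV, CoreIn.coreStep_L1]
  exact hrow

/-- **(V1) first-order variational test** over doubled tube × BV, for every unit-`ω` start `v₀`. [folklore] -/
theorem coreStep_V_test (hco : T.CoefOK φ) (hcB : CoefBoxOK φ T ci.coefB) (hmt : ci.mt = T.monosTable ci.coefB)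
    (hok : (T.coreStep ci).ok = true) {ω : ℤ → ℝ}
    (hωB : ∀ i k, -T.Kb ≤ k → k ≤ T.Ka → IntervalD.mem (ω k) (IntervalD.aget ci.ωB (T.idx i k))) :
    ∀ v₀ : Fin 4 → ℤ → ℝ, T.InBallW ω v₀ 1 →
      ∀ y v, T.InBoxW (T.vecF (vre (T.coreStep ci).lo) + T.vecF (vre (T.coreStep ci).loK) + T.vecF (vre (T.coreStep ci).loK))
          (T.vecF (vre (T.coreStep ci).hi) + T.vecF (vre (T.coreStep ci).hiK) + T.vecF (vre (T.coreStep ci).hiK)) y →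
        T.InBoxW (T.vecF (vre (T.coreStep ci).loV)) (T.vecF (vre (T.coreStep ci).hiV)) v → ∀ u ∈ Icc 0 ci.h.toReal,
          T.InBoxW (T.vecF (vre (T.coreStep ci).loV)) (T.vecF (vre (T.coreStep ci).hiV))
            (v₀ + u • ((T.toCertData φ).Qb y v + (T.toCertData φ).Qb v y)) := by
  intro v₀ hv₀ y v hy hv u hu i k hk1 hk2
  have hk : -T.Kb ≤ k ∧ k ≤ T.Ka := ⟨hk1, hk2⟩
  have hc : T.idx i k < T.n := T.idx_lt_n i hk
  have hyc := T.mem_TB2_of_inBoxW ci hy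
  have hvc := T.mem_BV_of_inBoxW ci hv
  have hlin : IntervalD.IsLinSymEnclosureF T.wv (qBf (T.toCertData φ)) T.n ci.prec (T.linSym ci.coefB ci.prec ci.mt) := by
    rw [hmt]; exact T.isLinSymEnclosureF_linSym hco hcB ci.prec
  have h1 := hlin (ci.TB2 T) (ci.BV T) y v (CoreIn.size_TB2 T ci) (CoreIn.size_BV T ci) hyc hvc (T.idx i k) hc
  have hg : IntervalD.mem (((T.toCertData φ).Qb y v + (T.toCertData φ).Qb v y) i k) (IntervalD.aget (ci.G' T) (T.idx i k)) := by
    unfold CoreIn.G'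
    rw [T.Qb_sym_apply, ← T.wv_idx (qBf (T.toCertData φ) y v) i hk, ← T.wv_idx (qBf (T.toCertData φ) v y) i hk]
    exact h1
  have hball : |v₀ i k| ≤ ω k := by simpa using hv₀ i k hk1 hk2
  have hm := IntervalD.mem_symBox_of_testK (T.coreStep_okV ci hok) hc (hωB i k hk1 hk2) hball hu hg
  rw [T.vecF_vre _ i hk, T.vecF_vre _ i hk, T.out_loV ci _ hc, CoreIn.coreStep_hiV]
  simp only [Pi.add_apply, Pi.smul_apply, smul_eq_mul]
  exact hm

/-! ### (JU) -/

/-- **(JU)** — the order-`pV+1` vector variational jets over doubled tube × BV are bounded by `JU`. [folklore] -/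
theorem coreStep_JU (hco : T.CoefOK φ) (hcB : CoefBoxOK φ T ci.coefB) (hmt : ci.mt = T.monosTable ci.coefB)
    (hok : (T.coreStep ci).ok = true) :
    ∀ y v, T.InBoxW (T.vecF (vre (T.coreStep ci).lo) + T.vecF (vre (T.coreStep ci).loK) + T.vecF (vre (T.coreStep ci).loK))
        (T.vecF (vre (T.coreStep ci).hi) + T.vecF (vre (T.coreStep ci).hiK) + T.vecF (vre (T.coreStep ci).hiK)) y →
      T.InBoxW (T.vecF (vre (T.coreStep ci).loV)) (T.vecF (vre (T.coreStep ci).hiV)) v →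
        ∀ i k, -T.Kb ≤ k → k ≤ T.Ka → |varJet (T.toCertData φ).Qb y v (ci.pV + 1) i k| ≤ T.vecF (vre (T.coreStep ci).JU) i k := by
  intro y v hy hv i k hk1 hk2
  have _ := hok
  have hk : -T.Kb ≤ k ∧ k ≤ T.Ka := ⟨hk1, hk2⟩
  have hc : T.idx i k < T.n := T.idx_lt_n i hk
  have hyc := T.mem_TB2_of_inBoxW ci hy
  have hvc := T.mem_BV_of_inBoxW ci hv
  have hlin : IntervalD.IsLinSymEnclosureF T.wv (qBf (T.toCertData φ)) T.n ci.prec (T.linSym ci.coefB ci.prec ci.mt) := by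
    rw [hmt]; exact T.isLinSymEnclosureF_linSym hco hcB ci.prec
  have hj := IntervalD.mem_varJet_of_wColLevelsF (rd := T.wv) (Q := qBf (T.toCertData φ)) (T := taylorJet (qBf (T.toCertData φ)))
    (U := varJet (qBf (T.toCertData φ))) (fun x c _ => by rw [taylorJet_zero])
    (fun x k c _ => T.wv_taylorJet_qBf_succ x k c) (fun x v c _ => by rw [TaylorModelReadout.varJet_zero])
    (fun x v k c _ => T.wv_varJet_qBf_succ x v k c) (T.coreQBA_sound ci hco hcB hmt) hlin (ci.pV + 1)
    (CoreIn.size_TB2 T ci) (CoreIn.size_BV T ci) hyc hvc (ci.pV + 1) le_rfl (T.idx i k) hc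
  rw [varJet_qBf, T.wv_idx _ i hk] at hj
  rw [T.vecF_vre _ i hk, CoreIn.coreStep_JU]
  unfold CoreIn.JUarr
  rw [dget_ofFn _ hc]
  exact IntervalD.abs_le_mag hj

end CertTables

end Summit.NavierStokesRegularity.NavierStokesRegularity.Theorems.TaylorModelCert
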